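import Literature.AlgebraicGeometry.Frobenioids.Thm49RightTransportMultiplicative
import Literature.AlgebraicGeometry.Frobenioids.PerfFactorialOrderIsoFixWeak
import HarnessLib

/-!
# [FrdI] Theorem 4.9, the extension step p. 89 ll. 9–17 (multiplicativity of the divisor transport along a
# pre-step), WEAKLY perf-factorial divisor monoids

Mochizuki, *The geometry of Frobenioids I: the general theory*, Kyushu J. Math. **62** (2008)
293–400, §4, proof of Theorem 4.9, p. 89 ll. 9–17 [cite: MochizukiFrdI2008, Thm. 4.9 p.89].

PROOF-ONLY file (cell abc-iut, layer L1, seat abc-iut-L1-t14; row «C411iii/iv-WEAK» = the [FrdI] Thm. 4.9 /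
Cor. 4.11 (iii)(iv) chain over `IsPerfFactorialWeak`, block (T2)). WEAK-HYPOTHESIS TWIN
`PreFrobenioid.transport_mul_of_preStep_to_weak` of the one perf-factorial-dependent theorem of
`Thm49RightTransportMultiplicative.lean` (seat abc-iut-w4-d035): "`Φ₁` perf-factorial" (Def. 2.4 (i) (a)–(d))
weakened to "`Φ₁` weakly perf-factorial" (`IsPerfFactorialWeak`; cell finding F-L2d2-1), the monoid input being
seat abc-iut-L1-t11's `IsPerfFactorialWeak.eq_of_dvd_iff_of_eq_on` (`PerfFactorialOrderIsoFixWeak.lean`). The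
hypothesis-free lemmas of the strong file (`transport_pull_of_dvd_div`, `transport_mul_pull_eq`,
`pull_dvd_iff_of_isIso`, `transport_mul_of_preStep_from`) are consumed BY NAME; proof verbatim. No new
definitions; nothing of the paper restated or strengthened; nothing here is specific to the abc programme and no
side is taken on [IUTchIII] Cor. 3.12.
-/

namespace Literature.AlgebraicGeometry.Frobenioids

open CategoryTheory Opposite

universe w v v' u u'

namespace PreFrobenioid

variable {D₁ : Type u} [Category.{v} D₁] {Φ₁ : D₁ᵒᵖ ⥤ CommMonCat.{w}} {C₁ : Type u'}
  [Category.{v'} C₁] {D₂ : Type u} [Category.{v} D₂] {Φ₂ : D₂ᵒᵖ ⥤ CommMonCat.{w}} {C₂ : Type u'}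
  [Category.{v'} C₂] {F₁ : C₁ ⥤ ElemFrobenioid Φ₁} {F₂ : C₂ ⥤ ElemFrobenioid Φ₂}

/-! ### Pull-backs along isomorphisms of the base
(bookkeeping; `pull_inv_pull`, `pull_pull_inv` are in `ElementaryIsomorphisms.lean`,
`RatFrac.pull_bijective_of_isIso` in `BiratUnitsPush.lean`) -/

/-- (WEAK setting: weakly perf-factorial `Φ₁`; twin of `transport_mul_of_preStep_to`.) **The extension step of the proof of Thm. 4.9 (p. 89 ll. 9–17), for the divisor transport.**
Frobenioids of isotropic type, `C₁` of perfect type, `Φ₁` perf-factorial, `Ψ` preserving pre-steps;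
`T` any family with `T_A(Div φ) = Div(Ψφ)`, each `T_A` a bijection compatible with `≤`. If at the
object `O` the map `T_O` is multiplicative and satisfies the left-hand clause (right-hand = left-hand
at `O`), then `T_W` is multiplicative for EVERY object `W` admitting a pre-step `ψ : W → O` — indeed
`T_W` coincides with `(Ψψ)^* ∘ T_O ∘ ψ_*` (they agree on the divisors and on the multiples of `Div ψ`,
`IsPerfFactorialWeak.eq_of_dvd_iff_of_eq_on`). [cite: MochizukiFrdI2008, Thm. 4.9 p.89] -/
theorem transport_mul_of_preStep_to_weak (Ψ : C₁ ≌ C₂) (hF₁ : IsFrobenioid F₁) (hF₂ : IsFrobenioid F₂)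
    (hperf₁ : IsOfPerfectType F₁) (histr₁ : IsOfIsotropicType F₁)
    (hpf₁ : Objectwise (fun M _ => IsPerfFactorialWeak M) Φ₁)
    (hpre : ∀ ⦃X Y : C₁⦄ (φ : X ⟶ Y), IsPreStep F₁ φ → IsPreStep F₂ (Ψ.functor.map φ))
    (T : ∀ A : C₁, Φ₁.obj (op (baseObj F₁ A)) → Φ₂.obj (op (baseObj F₂ (Ψ.functor.obj A))))
    (hTb : ∀ A, Function.Bijective (T A)) (hTd : ∀ A (x y), x ∣ y ↔ T A x ∣ T A y)
    (hT : ∀ ⦃A B : C₁⦄ (φ : A ⟶ B), IsPreStep F₁ φ → T A (Div F₁ φ) = Div F₂ (Ψ.functor.map φ))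
    {O : C₁} (hmulO : ∀ a b, T O (a * b) = T O a * T O b)
    (hRL : ∀ ⦃W' : C₁⦄ (χ : W' ⟶ O), IsPreStep F₁ χ → ∀ z : Φ₁.obj (op (baseObj F₁ O)),
      pull Φ₁ (Base F₁ χ) z = Div F₁ χ →
        pull Φ₂ (Base F₂ (Ψ.functor.map χ)) (T O z) = Div F₂ (Ψ.functor.map χ))
    {W : C₁} (ψ : W ⟶ O) (hψ : IsPreStep F₁ ψ) (a b : Φ₁.obj (op (baseObj F₁ W))) :
    T W (a * b) = T W a * T W b := by
  haveI : IsIso (Base F₁ ψ) := hψ.2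
  haveI : IsIso (Base F₂ (Ψ.functor.map ψ)) := (hpre ψ hψ).2
  -- the conjugate `g := (Ψψ)^* ∘ T_O ∘ ψ_*`
  let g : Φ₁.obj (op (baseObj F₁ W)) → Φ₂.obj (op (baseObj F₂ (Ψ.functor.obj W))) :=
    fun y => pull Φ₂ (Base F₂ (Ψ.functor.map ψ)) (T O (pull Φ₁ (inv (Base F₁ ψ)) y))
  have hg_mul : ∀ a b, g (a * b) = g a * g b := by
    intro a b; simp only [g, map_mul, hmulO]
  have hgb : Function.Bijective g :=
    (RatFrac.pull_bijective_of_isIso (Φ := Φ₂) (Base F₂ (Ψ.functor.map ψ))).comp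
      ((hTb O).comp (RatFrac.pull_bijective_of_isIso (Φ := Φ₁) (inv (Base F₁ ψ))))
  have hgd : ∀ x y, x ∣ y ↔ g x ∣ g y := by
    intro x y
    simp only [g]
    rw [← pull_dvd_iff_of_isIso, ← hTd O, ← pull_dvd_iff_of_isIso]
  -- `T_W` and `g` agree on the divisors and on the multiples of `Div ψ`
  have h₁ : ∀ p, IsPrimary p → p ∣ Div F₁ ψ → T W p = g p := by
    intro p _ hp
    have hp' : pull Φ₁ (Base F₁ ψ) (pull Φ₁ (inv (Base F₁ ψ)) p) ∣ Div F₁ ψ := by rwa [pull_pull_inv]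
    have h := transport_pull_of_dvd_div Ψ hF₁ hF₂ histr₁ hpre T hT hmulO hRL ψ hψ _ hp'
    rwa [pull_pull_inv] at h
  have h₂ : ∀ y, T W (Div F₁ ψ * y) = g (Div F₁ ψ * y) := by
    intro y
    have h := transport_mul_pull_eq Ψ hF₁ hpre T hT hmulO hRL ψ hψ
      (pull Φ₁ (inv (Base F₁ ψ)) (Div F₁ ψ)) (pull_pull_inv Φ₁ _ _) (pull Φ₁ (inv (Base F₁ ψ)) y)
    rw [pull_pull_inv] at h
    rw [h]
    simp only [g, map_mul]
  have hMp := isPerfect_divisorMonoid hF₁ hperf₁ W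
  have heq : ∀ y, T W y = g y :=
    IsPerfFactorialWeak.eq_of_dvd_iff_of_eq_on (hpf₁ _) hMp (T W) g (hTb W) hgb (hTd W) hgd (Div F₁ ψ) h₁ h₂
  rw [heq, heq, heq, hg_mul]

end PreFrobenioid

end Literature.AlgebraicGeometry.Frobenioids
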